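import Summits.CriticalPhenomena.PercolationContinuityZ3.Theorems.Transplant.FKConnectivityAllQPat3LevelsC
import Summits.CriticalPhenomena.PercolationContinuityZ3.Theorems.Transplant.FKConnectivityAllQPat3CornerGluing
import HarnessLib

/-!
# Connectivity correlation inequalities for `φ_{w,q}`, every `q > 0` — gluing laws WITH CONTRACTED SETS (Stage S3/S4 groundwork,
# part 2): exponents and patterns of a glued minor from its pieces

Theorems file (`--supports stmt-CriticalPhenomena-4575`), census lane `prim-bschramm-census` (gen 36) of the post-continuity programme (LANE 2 bschramm, FK sub-lane);
builds on p205010 (kernel theorem, internal audit signed; external expert review pending).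
No definitions, no named facts, no sorries; standard axioms.  The first C-versions (census g36 memo §23(a)) of the gluing laws,
showing the pattern: the reachability lemmas take the configurations `γ_p ∪ C_p` verbatim and fk-2's `clusterCount_series` /
`clusterCount_parallel` give the exponent laws for `FK.apExpC` on both members of the pair — `FK.apExpC_series_glued`,
`FK.apExpC_parallel_glued`, `FK.pat3C_union_serS` / **`FK.tvalC_union2_cutS`** (the marked 1-cut for minors), `FK.pat3C_union_serR` /
**`FK.tvalC_union2_cut1`** (the unmarked 1-cut for minors), `FK.apExpC_union2_corner` / `FK.pat3C_union2_corner` /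
**`FK.tvalC_union2_corner`** (the type-II law for minors). The edge-insertion bridge
(`contractXY`, `pat3_union_edge`, `lev2_insert_edge`) is the sibling file `…Pat3EdgeMinor.lean`.  The remaining
laws (serL/serR/par/corner/theta/ring) follow the same three-line recipe (`Finset.union_union_union_comm` — the tree's `FK.union_union_glue` —, `FK.sdiff_union_union_distrib`).
[cite: Grimmett2006, §1.4 eq. (1.20) (p. 15); §3.8 (pp. 61–62)]
-/

noncomputable section

namespace Summit.CriticalPhenomena.PercolationContinuityZ3.Theorems

namespace FK

open SimpleGraph Literature.Probability.LatticeModels Literature.Probability.Percolation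

/-! ### Gluing laws WITH CONTRACTED SETS (census g36 memo §23(a)): exponents and patterns of `(E₁ ∪ E₂, C₁ ∪ C₂)` from the pieces -/

section GluingC

open scoped Classical

variable {V : Type*}

/-- Set bookkeeping for the complementary member of the pair. [folklore] -/
theorem sdiff_union_union_distrib {E₁ E₂ : Finset (Sym2 V)} (hd : Disjoint E₁ E₂) {γ₁ γ₂ : Finset (Sym2 V)} (g₁ : γ₁ ⊆ E₁)
    (g₂ : γ₂ ⊆ E₂) (C₁ C₂ : Finset (Sym2 V)) :
    (E₁ ∪ E₂) \ (γ₁ ∪ γ₂) ∪ (C₁ ∪ C₂) = E₁ \ γ₁ ∪ C₁ ∪ (E₂ \ γ₂ ∪ C₂) := by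
  rw [union_sdiff_union hd g₁ g₂, Finset.union_union_union_comm]

variable [Fintype V] {E₁ E₂ C₁ C₂ : Finset (Sym2 V)} {V₁ V₂ : Set V}

/-- **Contracted exponent across a SERIES gluing** (variant of fk-2's `FK.apExpC_series` with the vertex hypotheses on the glued pieces `E_i ∪ C_i` themselves) (pieces `(E₁, C₁)`, `(E₂, C₂)` with supports `V₁, V₂` meeting inside `{m}`):
`apExpC` is additive up to `2|V|` (fk-2's `clusterCount_series` on both members of the pair). [folklore] -/
theorem apExpC_series_glued (hd : Disjoint E₁ E₂) (h₁ : ∀ e ∈ (↑(E₁ ∪ C₁) : Set (Sym2 V)), ∀ z ∈ e, z ∈ V₁)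
    (h₂ : ∀ e ∈ (↑(E₂ ∪ C₂) : Set (Sym2 V)), ∀ z ∈ e, z ∈ V₂) {m : V} (hS : V₁ ∩ V₂ ⊆ {m})
    {γ₁ γ₂ : Finset (Sym2 V)} (g₁ : γ₁ ⊆ E₁) (g₂ : γ₂ ⊆ E₂) :
    apExpC (E₁ ∪ E₂) (C₁ ∪ C₂) (γ₁ ∪ γ₂) + 2 * Fintype.card V = apExpC E₁ C₁ γ₁ + apExpC E₂ C₂ γ₂ := by
  have k1 := clusterCount_series (ω₁ := (↑(γ₁ ∪ C₁) : Set (Sym2 V))) (ω₂ := (↑(γ₂ ∪ C₂) : Set (Sym2 V))) h₁ h₂ hS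
    (Finset.coe_subset.2 (Finset.union_subset_union g₁ le_rfl)) (Finset.coe_subset.2 (Finset.union_subset_union g₂ le_rfl))
  have k2 := clusterCount_series (ω₁ := (↑(E₁ \ γ₁ ∪ C₁) : Set (Sym2 V))) (ω₂ := (↑(E₂ \ γ₂ ∪ C₂) : Set (Sym2 V))) h₁ h₂ hS
    (Finset.coe_subset.2 (Finset.union_subset_union Finset.sdiff_subset le_rfl))
    (Finset.coe_subset.2 (Finset.union_subset_union Finset.sdiff_subset le_rfl))
  have e1 : (↑(γ₁ ∪ C₁ ∪ (γ₂ ∪ C₂)) : Set (Sym2 V)) = ↑(γ₁ ∪ C₁) ∪ ↑(γ₂ ∪ C₂) := Finset.coe_union _ _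
  have e2 : (↑(E₁ \ γ₁ ∪ C₁ ∪ (E₂ \ γ₂ ∪ C₂)) : Set (Sym2 V)) = ↑(E₁ \ γ₁ ∪ C₁) ∪ ↑(E₂ \ γ₂ ∪ C₂) :=
    Finset.coe_union _ _
  unfold apExpC
  rw [Finset.union_union_union_comm, sdiff_union_union_distrib hd g₁ g₂, e1, e2]
  omega

/-- **Contracted exponent across a PARALLEL gluing** (variant of fk-2's `FK.apExpC_parallel`) (supports meeting inside `{s, t}`, `s ≠ t`): additive up to `2|V|` and the
two cycle corrections `1{s ~ t in both pieces}` (on the pair's two members). [folklore] -/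
theorem apExpC_parallel_glued (hd : Disjoint E₁ E₂) (h₁ : ∀ e ∈ (↑(E₁ ∪ C₁) : Set (Sym2 V)), ∀ z ∈ e, z ∈ V₁)
    (h₂ : ∀ e ∈ (↑(E₂ ∪ C₂) : Set (Sym2 V)), ∀ z ∈ e, z ∈ V₂) {s t : V} (hS : V₁ ∩ V₂ ⊆ {s, t}) (hst : s ≠ t)
    {γ₁ γ₂ : Finset (Sym2 V)} (g₁ : γ₁ ⊆ E₁) (g₂ : γ₂ ⊆ E₂) :
    apExpC (E₁ ∪ E₂) (C₁ ∪ C₂) (γ₁ ∪ γ₂) + 2 * Fintype.card V =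
      apExpC E₁ C₁ γ₁ + apExpC E₂ C₂ γ₂ +
        ((if (openGraph (↑(γ₁ ∪ C₁) : BondConfig V)).Reachable s t ∧ (openGraph (↑(γ₂ ∪ C₂) : BondConfig V)).Reachable s t
            then 1 else 0) +
          (if (openGraph (↑(E₁ \ γ₁ ∪ C₁) : BondConfig V)).Reachable s t ∧
              (openGraph (↑(E₂ \ γ₂ ∪ C₂) : BondConfig V)).Reachable s t then 1 else 0)) := by
  have k1 := clusterCount_parallel (ω₁ := (↑(γ₁ ∪ C₁) : Set (Sym2 V))) (ω₂ := (↑(γ₂ ∪ C₂) : Set (Sym2 V))) h₁ h₂ hS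
    (Finset.coe_subset.2 (Finset.union_subset_union g₁ le_rfl)) (Finset.coe_subset.2 (Finset.union_subset_union g₂ le_rfl)) hst
  have k2 := clusterCount_parallel (ω₁ := (↑(E₁ \ γ₁ ∪ C₁) : Set (Sym2 V))) (ω₂ := (↑(E₂ \ γ₂ ∪ C₂) : Set (Sym2 V))) h₁ h₂ hS
    (Finset.coe_subset.2 (Finset.union_subset_union Finset.sdiff_subset le_rfl))
    (Finset.coe_subset.2 (Finset.union_subset_union Finset.sdiff_subset le_rfl)) hst
  have e1 : (↑(γ₁ ∪ C₁ ∪ (γ₂ ∪ C₂)) : Set (Sym2 V)) = ↑(γ₁ ∪ C₁) ∪ ↑(γ₂ ∪ C₂) := Finset.coe_union _ _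
  have e2 : (↑(E₁ \ γ₁ ∪ C₁ ∪ (E₂ \ γ₂ ∪ C₂)) : Set (Sym2 V)) = ↑(E₁ \ γ₁ ∪ C₁) ∪ ↑(E₂ \ γ₂ ∪ C₂) :=
    Finset.coe_union _ _
  unfold apExpC
  rw [Finset.union_union_union_comm, sdiff_union_union_distrib hd g₁ g₂, e1, e2]
  omega

omit [Fintype V] in
/-- **Patterns of the glued minor, SERIES at the mark** (C-version of `FK.pat3_union_serS`). [folklore] -/
theorem pat3C_union_serS (hd : Disjoint E₁ E₂) (h₁ : ∀ e ∈ (↑(E₁ ∪ C₁) : Set (Sym2 V)), ∀ z ∈ e, z ∈ V₁)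
    (h₂ : ∀ e ∈ (↑(E₂ ∪ C₂) : Set (Sym2 V)), ∀ z ∈ e, z ∈ V₂) {x s y : V} (hS : V₁ ∩ V₂ ⊆ {s}) (hxV : x ∉ V₂)
    (hyV : y ∉ V₁) (hxs : x ≠ s) (hys : y ≠ s) (hxy : x ≠ y) {γ₁ γ₂ : Finset (Sym2 V)} (g₁ : γ₁ ⊆ E₁) (g₂ : γ₂ ⊆ E₂) :
    pat3 (γ₁ ∪ γ₂ ∪ (C₁ ∪ C₂)) x y s = joinSerS (conn (γ₁ ∪ C₁) x s) (conn (γ₂ ∪ C₂) s y) ∧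
      pat3 ((E₁ ∪ E₂) \ (γ₁ ∪ γ₂) ∪ (C₁ ∪ C₂)) x y s = joinSerS (conn (E₁ \ γ₁ ∪ C₁) x s) (conn (E₂ \ γ₂ ∪ C₂) s y) := by
  rw [Finset.union_union_union_comm, sdiff_union_union_distrib hd g₁ g₂]
  exact ⟨pat3_union_serS h₁ h₂ hS hxV hyV hxs hys hxy (Finset.union_subset_union g₁ le_rfl)
      (Finset.union_subset_union g₂ le_rfl),
    pat3_union_serS h₁ h₂ hS hxV hyV hxs hys hxy (Finset.union_subset_union Finset.sdiff_subset le_rfl)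
      (Finset.union_subset_union Finset.sdiff_subset le_rfl)⟩

/-- **BILINEAR DECOMPOSITION OF `tvalC` OVER A MARKED 1-CUT of minors** (C-version of `FK.tval_union2_cutS`; the contracted
sets ride along inside both members of the pair). [folklore] -/
theorem tvalC_union2_cutS (hd : Disjoint E₁ E₂) (h₁ : ∀ e ∈ (↑(E₁ ∪ C₁) : Set (Sym2 V)), ∀ z ∈ e, z ∈ V₁)
    (h₂ : ∀ e ∈ (↑(E₂ ∪ C₂) : Set (Sym2 V)), ∀ z ∈ e, z ∈ V₂) {x s y : V} (hS : V₁ ∩ V₂ ⊆ {s}) (hxV : x ∉ V₂)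
    (hyV : y ∉ V₁) (hxs : x ≠ s) (hys : y ≠ s) (hxy : x ≠ y) (wt : ℕ → ℝ) (tab : Pat3 → Pat3 → ℤ) :
    tvalC (fun n => wt (n + 2 * Fintype.card V)) (E₁ ∪ E₂) (C₁ ∪ C₂) x y s tab =
      ∑ γ₁ ∈ E₁.powerset, ∑ γ₂ ∈ E₂.powerset,
        wt (apExpC E₁ C₁ γ₁ + apExpC E₂ C₂ γ₂) *
          (tab (joinSerS (conn (γ₁ ∪ C₁) x s) (conn (γ₂ ∪ C₂) s y))
            (joinSerS (conn (E₁ \ γ₁ ∪ C₁) x s) (conn (E₂ \ γ₂ ∪ C₂) s y)) : ℝ) := by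
  unfold tvalC
  beta_reduce
  rw [sum_powerset_union_disj hd]
  refine Finset.sum_congr rfl fun γ₁ hγ₁ => Finset.sum_congr rfl fun γ₂ hγ₂ => ?_
  have g₁ := Finset.mem_powerset.1 hγ₁
  have g₂ := Finset.mem_powerset.1 hγ₂
  obtain ⟨p1, p2⟩ := pat3C_union_serS hd h₁ h₂ hS hxV hyV hxs hys hxy g₁ g₂ (C₁ := C₁) (C₂ := C₂)
  rw [apExpC_series_glued hd h₁ h₂ hS g₁ g₂, p1, p2]

omit [Fintype V] in
/-- **Patterns of the glued minor, SERIES with the mark in the first part** (C-version of `FK.pat3_union_serR`). [folklore] -/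
theorem pat3C_union_serR (hd : Disjoint E₁ E₂) (h₁ : ∀ e ∈ (↑(E₁ ∪ C₁) : Set (Sym2 V)), ∀ z ∈ e, z ∈ V₁)
    (h₂ : ∀ e ∈ (↑(E₂ ∪ C₂) : Set (Sym2 V)), ∀ z ∈ e, z ∈ V₂) {x w y s : V} (hS : V₁ ∩ V₂ ⊆ {w}) (hxV : x ∉ V₂)
    (hsV : s ∉ V₂) (hyV : y ∉ V₁) (hxw : x ≠ w) (hyw : y ≠ w) (hxy : x ≠ y) (hsw : s ≠ w) (hsy : s ≠ y)
    {γ₁ γ₂ : Finset (Sym2 V)} (g₁ : γ₁ ⊆ E₁) (g₂ : γ₂ ⊆ E₂) :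
    pat3 (γ₁ ∪ γ₂ ∪ (C₁ ∪ C₂)) x y s = joinSerR (conn (γ₂ ∪ C₂) w y) (pat3 (γ₁ ∪ C₁) x w s) ∧
      pat3 ((E₁ ∪ E₂) \ (γ₁ ∪ γ₂) ∪ (C₁ ∪ C₂)) x y s =
        joinSerR (conn (E₂ \ γ₂ ∪ C₂) w y) (pat3 (E₁ \ γ₁ ∪ C₁) x w s) := by
  rw [Finset.union_union_union_comm, sdiff_union_union_distrib hd g₁ g₂]
  exact ⟨pat3_union_serR h₁ h₂ hS hxV hsV hyV hxw hyw hxy hsw hsy (Finset.union_subset_union g₁ le_rfl)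
      (Finset.union_subset_union g₂ le_rfl),
    pat3_union_serR h₁ h₂ hS hxV hsV hyV hxw hyw hxy hsw hsy (Finset.union_subset_union Finset.sdiff_subset le_rfl)
      (Finset.union_subset_union Finset.sdiff_subset le_rfl)⟩

/-- **BILINEAR DECOMPOSITION OF `tvalC` OVER AN UNMARKED 1-CUT of minors** (C-version of `FK.tval_union2_cut1`). [folklore] -/
theorem tvalC_union2_cut1 (hd : Disjoint E₁ E₂) (h₁ : ∀ e ∈ (↑(E₁ ∪ C₁) : Set (Sym2 V)), ∀ z ∈ e, z ∈ V₁)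
    (h₂ : ∀ e ∈ (↑(E₂ ∪ C₂) : Set (Sym2 V)), ∀ z ∈ e, z ∈ V₂) {x w y s : V} (hS : V₁ ∩ V₂ ⊆ {w}) (hxV : x ∉ V₂)
    (hsV : s ∉ V₂) (hyV : y ∉ V₁) (hxw : x ≠ w) (hyw : y ≠ w) (hxy : x ≠ y) (hsw : s ≠ w) (hsy : s ≠ y)
    (wt : ℕ → ℝ) (tab : Pat3 → Pat3 → ℤ) :
    tvalC (fun n => wt (n + 2 * Fintype.card V)) (E₁ ∪ E₂) (C₁ ∪ C₂) x y s tab =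
      ∑ γ₁ ∈ E₁.powerset, ∑ γ₂ ∈ E₂.powerset,
        wt (apExpC E₁ C₁ γ₁ + apExpC E₂ C₂ γ₂) *
          (tab (joinSerR (conn (γ₂ ∪ C₂) w y) (pat3 (γ₁ ∪ C₁) x w s))
            (joinSerR (conn (E₂ \ γ₂ ∪ C₂) w y) (pat3 (E₁ \ γ₁ ∪ C₁) x w s)) : ℝ) := by
  unfold tvalC
  beta_reduce
  rw [sum_powerset_union_disj hd]
  refine Finset.sum_congr rfl fun γ₁ hγ₁ => Finset.sum_congr rfl fun γ₂ hγ₂ => ?_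
  have g₁ := Finset.mem_powerset.1 hγ₁
  have g₂ := Finset.mem_powerset.1 hγ₂
  obtain ⟨p1, p2⟩ := pat3C_union_serR hd h₁ h₂ hS hxV hsV hyV hxw hyw hxy hsw hsy g₁ g₂ (C₁ := C₁) (C₂ := C₂)
  rw [apExpC_series_glued hd h₁ h₂ hS g₁ g₂, p1, p2]

/-- **Contracted exponent across a CORNER gluing** (C-version of `FK.apExp_union2_corner`): the corrections are `corrC` of the
pieces' C-patterns. [folklore] -/
theorem apExpC_union2_corner (hd : Disjoint E₁ E₂) (h₁ : ∀ e ∈ (↑(E₁ ∪ C₁) : Set (Sym2 V)), ∀ z ∈ e, z ∈ V₁)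
    (h₂ : ∀ e ∈ (↑(E₂ ∪ C₂) : Set (Sym2 V)), ∀ z ∈ e, z ∈ V₂) {u v : V} (h12 : V₁ ∩ V₂ ⊆ ({u, v} : Set V)) (huv : u ≠ v)
    (s t : V) {γ₁ γ₂ : Finset (Sym2 V)} (g₁ : γ₁ ⊆ E₁) (g₂ : γ₂ ⊆ E₂) :
    apExpC (E₁ ∪ E₂) (C₁ ∪ C₂) (γ₁ ∪ γ₂) + 2 * Fintype.card V =
      apExpC E₁ C₁ γ₁ + apExpC E₂ C₂ γ₂ + corrC (pat3 (γ₁ ∪ C₁) u v s) (pat3 (γ₂ ∪ C₂) u v t) +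
        corrC (pat3 (E₁ \ γ₁ ∪ C₁) u v s) (pat3 (E₂ \ γ₂ ∪ C₂) u v t) := by
  have e1 := apExpC_parallel_glued hd h₁ h₂ h12 huv g₁ g₂ (C₁ := C₁) (C₂ := C₂)
  rw [ite_prop_eq_ite_bool (p := (openGraph (↑(γ₁ ∪ C₁) : BondConfig V)).Reachable u v ∧
        (openGraph (↑(γ₂ ∪ C₂) : BondConfig V)).Reachable u v)
      (bb := (pat3 (γ₁ ∪ C₁) u v s).xy && (pat3 (γ₂ ∪ C₂) u v t).xy) (by rw [Bool.and_eq_true, pat3_xy_iff, pat3_xy_iff]),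
    ite_prop_eq_ite_bool
      (p := (openGraph (↑(E₁ \ γ₁ ∪ C₁) : BondConfig V)).Reachable u v ∧ (openGraph (↑(E₂ \ γ₂ ∪ C₂) : BondConfig V)).Reachable u v)
      (bb := (pat3 (E₁ \ γ₁ ∪ C₁) u v s).xy && (pat3 (E₂ \ γ₂ ∪ C₂) u v t).xy)
      (by rw [Bool.and_eq_true, pat3_xy_iff, pat3_xy_iff])] at e1
  unfold corrC
  omega

omit [Fintype V] in
/-- **Patterns of the glued minor, CORNER configuration** (C-version of `FK.pat3_union2_corner`). [folklore] -/
theorem pat3C_union2_corner (hd : Disjoint E₁ E₂) (h₁ : ∀ e ∈ (↑(E₁ ∪ C₁) : Set (Sym2 V)), ∀ z ∈ e, z ∈ V₁)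
    (h₂ : ∀ e ∈ (↑(E₂ ∪ C₂) : Set (Sym2 V)), ∀ z ∈ e, z ∈ V₂) {u v : V} (h12 : V₁ ∩ V₂ ⊆ ({u, v} : Set V)) {s t : V}
    (hs2 : s ∉ V₂) (ht1 : t ∉ V₁) (hsu : s ≠ u) (hsv : s ≠ v) (htu : t ≠ u) (htv : t ≠ v) (hst : s ≠ t)
    {γ₁ γ₂ : Finset (Sym2 V)} (g₁ : γ₁ ⊆ E₁) (g₂ : γ₂ ⊆ E₂) :
    pat3 (γ₁ ∪ γ₂ ∪ (C₁ ∪ C₂)) u s t = joinC (pat3 (γ₁ ∪ C₁) u v s) (pat3 (γ₂ ∪ C₂) u v t) ∧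
      pat3 ((E₁ ∪ E₂) \ (γ₁ ∪ γ₂) ∪ (C₁ ∪ C₂)) u s t = joinC (pat3 (E₁ \ γ₁ ∪ C₁) u v s) (pat3 (E₂ \ γ₂ ∪ C₂) u v t) := by
  rw [Finset.union_union_union_comm, sdiff_union_union_distrib hd g₁ g₂]
  exact ⟨pat3_union2_corner h₁ h₂ h12 hs2 ht1 hsu hsv htu htv hst (Finset.union_subset_union g₁ le_rfl)
      (Finset.union_subset_union g₂ le_rfl),
    pat3_union2_corner h₁ h₂ h12 hs2 ht1 hsu hsv htu htv hst (Finset.union_subset_union Finset.sdiff_subset le_rfl)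
      (Finset.union_subset_union Finset.sdiff_subset le_rfl)⟩

/-- **BILINEAR DECOMPOSITION OF `tvalC` OVER A CORNER gluing of minors** (C-version of `FK.tval_union2_corner`: census g32's
type-II law for minors — the contracted sets ride along). [folklore] -/
theorem tvalC_union2_corner (hd : Disjoint E₁ E₂) (h₁ : ∀ e ∈ (↑(E₁ ∪ C₁) : Set (Sym2 V)), ∀ z ∈ e, z ∈ V₁)
    (h₂ : ∀ e ∈ (↑(E₂ ∪ C₂) : Set (Sym2 V)), ∀ z ∈ e, z ∈ V₂) {u v : V} (h12 : V₁ ∩ V₂ ⊆ ({u, v} : Set V)) (huv : u ≠ v)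
    {s t : V} (hs2 : s ∉ V₂) (ht1 : t ∉ V₁) (hsu : s ≠ u) (hsv : s ≠ v) (htu : t ≠ u) (htv : t ≠ v) (hst : s ≠ t)
    (wt : ℕ → ℝ) (tab : Pat3 → Pat3 → ℤ) :
    tvalC (fun n => wt (n + 2 * Fintype.card V)) (E₁ ∪ E₂) (C₁ ∪ C₂) u s t tab =
      ∑ γ₁ ∈ E₁.powerset, ∑ γ₂ ∈ E₂.powerset,
        wt (apExpC E₁ C₁ γ₁ + apExpC E₂ C₂ γ₂ + corrC (pat3 (γ₁ ∪ C₁) u v s) (pat3 (γ₂ ∪ C₂) u v t) +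
            corrC (pat3 (E₁ \ γ₁ ∪ C₁) u v s) (pat3 (E₂ \ γ₂ ∪ C₂) u v t)) *
          (tab (joinC (pat3 (γ₁ ∪ C₁) u v s) (pat3 (γ₂ ∪ C₂) u v t))
            (joinC (pat3 (E₁ \ γ₁ ∪ C₁) u v s) (pat3 (E₂ \ γ₂ ∪ C₂) u v t)) : ℝ) := by
  unfold tvalC
  beta_reduce
  rw [sum_powerset_union_disj hd]
  refine Finset.sum_congr rfl fun γ₁ hγ₁ => Finset.sum_congr rfl fun γ₂ hγ₂ => ?_
  have g₁ := Finset.mem_powerset.1 hγ₁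
  have g₂ := Finset.mem_powerset.1 hγ₂
  obtain ⟨p1, p2⟩ := pat3C_union2_corner hd h₁ h₂ h12 hs2 ht1 hsu hsv htu htv hst g₁ g₂ (C₁ := C₁) (C₂ := C₂)
  rw [apExpC_union2_corner hd h₁ h₂ h12 huv s t g₁ g₂, p1, p2]

end GluingC

end FK

end Summit.CriticalPhenomena.PercolationContinuityZ3.Theorems

end
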